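import Summits.PneNP.PneNP.Theorems.KarlinRubinMonotoneBlindDelta
import Summits.PneNP.PneNP.Theorems.KarlinRubinErdosRenyiNoLargeClique
import Summits.PneNP.PneNP.Theorems.KarlinRubinCliqueCircuitsOfNotPneNP

/-!
# Crux `MonotoneSuffices` (stmt-PneNP-18026, route KarlinRubin) — decomposition census r1, part 1: the dominating hypotheses close the summit alone

Part of the DECOMPOSITION r1 audit of the crux (2026-08-17): canonical census
`Cruxes/MonotoneSuffices/STRATEGY-CENSUS.md` (planner-cstrat-stmt-PneNP-18026-r1-0, workfile `DecompositionAudit.lean`) and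
the second-seat addendum (item evidence `STRATEGY-CENSUS-r1b.md`, planner-rtask-PneNP-KarlinRubin-kr-decomp-r1-64ab4eaa-0,
this file's author; the two seats were staffed on the same coordinator instruction and converged independently). Helpers
`--supports stmt-PneNP-18026`; every theorem is a COMPOSITION of landed tree theorems; nothing here is new mathematics —
the files exist so that the census's `strategy: no-strategy` line points at kernel-checked implications instead of prose.

* §0 the hypotheses under audit as named propositions: `PolyHardB2At δ`, `PolyHardB2`, `QuasiPolyHardB2` (verbatim the
  hypotheses of the landed `karlinRubin_monotoneBlind_of_noPolyB2Detector` / `karlinRubin_monotoneSuffices_of_quasipolyHard`)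
  and `SliceBlind` (verbatim the registered open stub `stub_sliceBlind` of line `slice-transport`).
* §1 `pneNP_of_polyHardB2At_quarter` (the body of `KarlinRubin.closes` with both cruxes excised: polynomial `B₂`
  planted-clique hardness at the single exponent `δ = 1/4` gives `PneNP`), `pneNP_of_polyHardB2`, and
  `pneNP_of_quasipolyHardB2` — the only known sufficient condition of the crux (`QuasiPolyHardB2 → MonotoneSuffices`,
  landed sandwich) closes the summit on its own: the tribunal's T1 pattern "a dominating `H ⇒ C` with `H ⇒ S` alone".

Parts 2–3: `KarlinRubinMonotoneSufficesDecompCensusSlice.lean` (the slice split's open piece gives `X` and `S` alone),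
`KarlinRubinMonotoneSufficesDecompCensusSplits.lean` (the other typed splits with proved glue).
-/

set_option linter.dupNamespace false -- `Summit.PneNP.PneNP.…`: summit = sub-problem name (D-0017 single-conjunct layout)

namespace Summit.PneNP.PneNP.Theorems

open Filter Topology Finset
open scoped Classical ENNReal
open Literature.Computability.Complexity Literature.Probability.RandomGraphs.PlantedClique
open Summit.PneNP.PneNP.Theses.KarlinRubin

/-! ## §0 The hypotheses under audit, as named propositions -/

/-- **Polynomial nonuniform planted-clique hardness for `B₂`-circuits at exponent `δ`**: no family of fan-in-2
circuits of size `≤ n^c` (eventually) has `G(n,1/2)`-acceptance plus planted-`⌈n^{1/2-δ}⌉`-clique rejection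
probability `→ 0`. (The conclusion of `karlinRubin_noPolyDetector_of_monotoneSuffices_of_monotoneBlind` at `δ`.) -/
def PolyHardB2At (δ : ℝ) : Prop :=
  ∀ c : ℕ, ¬ ∃ C : (n : ℕ) → Circuit ((⊤ : SimpleGraph (Fin n)).edgeSet),
    (∀ᶠ n : ℕ in atTop, (C n).IsOver B2 ∧ (C n).size ≤ n ^ c) ∧
      Tendsto (fun n : ℕ =>
        (erdosRenyiHalf n).toOuterMeasure {x | (C n).eval x = true} +
          (plantedCliqueDist n ⌈(n : ℝ) ^ (1 / 2 - δ)⌉₊).toOuterMeasure {x | (C n).eval x = false})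
        atTop (𝓝 0)

/-- `PolyHardB2At δ` at every `δ ∈ (0,1/2)` (verbatim the hypothesis of
`karlinRubin_monotoneBlind_of_noPolyB2Detector`). -/
def PolyHardB2 : Prop :=
  ∀ δ : ℝ, 0 < δ → δ < 1 / 2 → ∀ c : ℕ, ¬ ∃ C : (n : ℕ) → Circuit ((⊤ : SimpleGraph (Fin n)).edgeSet),
    (∀ᶠ n : ℕ in atTop, (C n).IsOver B2 ∧ (C n).size ≤ n ^ c) ∧
      Tendsto (fun n : ℕ =>
        (erdosRenyiHalf n).toOuterMeasure {x | (C n).eval x = true} +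
          (plantedCliqueDist n ⌈(n : ℝ) ^ (1 / 2 - δ)⌉₊).toOuterMeasure {x | (C n).eval x = false})
        atTop (𝓝 0)

/-- **Quasi-polynomial nonuniform planted-clique hardness for `B₂`-circuits** (verbatim the hypothesis of
`karlinRubin_monotoneSuffices_of_quasipolyHard`): every strongly detecting `B₂` family has `n^⌊log₂ n⌋ ≤ size^c`
eventually. -/
def QuasiPolyHardB2 : Prop :=
  ∀ δ : ℝ, 0 < δ → δ < 1 / 2 → ∃ c : ℕ,
    ∀ C : (n : ℕ) → Circuit ((⊤ : SimpleGraph (Fin n)).edgeSet),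
      (∀ᶠ n : ℕ in atTop, (C n).IsOver B2) →
      Tendsto (fun n : ℕ =>
        (erdosRenyiHalf n).toOuterMeasure {x | (C n).eval x = true} +
          (plantedCliqueDist n ⌈(n : ℝ) ^ (1 / 2 - δ)⌉₊).toOuterMeasure {x | (C n).eval x = false})
        atTop (𝓝 0) →
      ∀ᶠ n : ℕ in atTop, n ^ (Nat.log 2 n) ≤ (C n).size ^ c

/-- **The open piece of the slice split** (verbatim the registered stub `stub_sliceBlind` of
`Cruxes/MonotoneSuffices/Lines/slice_transport.lean`): for `δ ∈ (0,1/2)` there is `e ≥ 1` such that every family of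
`{∧₂, ∨₂}`-circuits whose SLICE error sum at `m⋆(n) = ⌊C(n,2)/2⌋ + n(⌊log₂ n⌋+1)` (uniform `m⋆`-edge graphs versus
`K_A ∪` uniform completion to `m⋆` edges, `|A| = ⌈n^{1/2-δ}⌉`) tends to `0` has `2^{⌊log₂ n⌋²} ≤ |M n|^e` eventually. -/
def SliceBlind : Prop :=
  ∀ δ : ℝ, 0 < δ → δ < 1 / 2 → ∃ e : ℕ, 0 < e ∧
    ∀ M : (n : ℕ) → Circuit ((⊤ : SimpleGraph (Fin n)).edgeSet),
      (∀ᶠ n : ℕ in atTop, (M n).IsOver monotoneBasis) →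
      Tendsto (fun n : ℕ =>
          ((univ.filter fun x : EdgeVec n =>
                (univ.filter fun e => x e = true).card = n.choose 2 / 2 + n * (Nat.log 2 n + 1) ∧
                  (M n).eval x = true).card : ℝ) /
              ((univ.filter fun x : EdgeVec n =>
                (univ.filter fun e => x e = true).card = n.choose 2 / 2 + n * (Nat.log 2 n + 1)).card : ℝ) +
          (((kSubsets n ⌈(n : ℝ) ^ (1 / 2 - δ)⌉₊ ×ˢ (univ : Finset (EdgeVec n))).filter fun p =>
                plant p.1 p.2 = p.2 ∧
                  (univ.filter fun e => p.2 e = true).card = n.choose 2 / 2 + n * (Nat.log 2 n + 1) ∧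
                    (M n).eval p.2 = false).card : ℝ) /
              (((kSubsets n ⌈(n : ℝ) ^ (1 / 2 - δ)⌉₊ ×ˢ (univ : Finset (EdgeVec n))).filter fun p =>
                plant p.1 p.2 = p.2 ∧
                  (univ.filter fun e => p.2 e = true).card =
                    n.choose 2 / 2 + n * (Nat.log 2 n + 1)).card : ℝ))
        atTop (nhds 0) →
      ∀ᶠ n : ℕ in atTop, 2 ^ (Nat.log 2 n ^ 2) ≤ (M n).size ^ e

/-! ## §1 The dominating hypotheses close the summit alone -/

/-- Quasi-polynomial beats polynomial: `n^d < 2^{⌊log₂ n⌋²}` once `n ≥ 2^{d+2}`. [folklore] -/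
theorem pow_lt_two_pow_log_sq {d n : ℕ} (hn : 2 ^ (d + 2) ≤ n) : n ^ d < 2 ^ (Nat.log 2 n ^ 2) := by
  set L := Nat.log 2 n with hL
  have hLd : d + 2 ≤ L := Nat.le_log_of_pow_le (by norm_num) hn
  have hnlt : n < 2 ^ (L + 1) := Nat.lt_pow_succ_log_self (by norm_num) n
  have h1 : n ^ d ≤ (2 ^ (L + 1)) ^ d := Nat.pow_le_pow_left hnlt.le d
  have h2 : (L + 1) * d < L ^ 2 := by
    have h3 : L * (d + 2) ≤ L * L := Nat.mul_le_mul_left L hLd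
    calc (L + 1) * d = L * d + d := by ring
      _ < L * d + 2 * L := by omega
      _ = L * (d + 2) := by ring
      _ ≤ L * L := h3
      _ = L ^ 2 := (sq L).symm
  calc n ^ d ≤ (2 ^ (L + 1)) ^ d := h1
    _ = 2 ^ ((L + 1) * d) := by rw [← pow_mul]
    _ < 2 ^ (L ^ 2) := Nat.pow_lt_pow_right (by norm_num) h2

/-- Quasi-polynomial hardness is polynomial hardness. [folklore] -/
theorem polyHardB2_of_quasipolyHardB2 (H : QuasiPolyHardB2) : PolyHardB2 := by
  intro δ hδ hδ' c hex
  obtain ⟨C, hC, hT⟩ := hex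
  obtain ⟨c', hc'⟩ := H δ hδ hδ'
  have hhard := hc' C (hC.mono fun n h => h.1) hT
  obtain ⟨n, hn1, hn2, hn3⟩ := (hhard.and (hC.and (eventually_ge_atTop (2 ^ (c * c' + 1))))).exists
  have hL : c * c' + 1 ≤ Nat.log 2 n := Nat.le_log_of_pow_le (by norm_num) hn3
  have hn2' : 2 ≤ n := le_trans (by calc 2 = 2 ^ 1 := rfl
                                        _ ≤ 2 ^ (c * c' + 1) := Nat.pow_le_pow_right (by norm_num) (by omega)) hn3
  have hlt : (C n).size ^ c' < n ^ (Nat.log 2 n) :=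
    calc (C n).size ^ c' ≤ (n ^ c) ^ c' := Nat.pow_le_pow_left hn2.2 c'
      _ = n ^ (c * c') := by rw [← pow_mul]
      _ < n ^ (c * c' + 1) := Nat.pow_lt_pow_right (by omega) (by omega)
      _ ≤ n ^ (Nat.log 2 n) := Nat.pow_le_pow_right (by omega) hL
  exact absurd hn1 (not_le.2 hlt)

/-- **`¬ PneNP` gives a polynomial `B₂` strong detector at `δ = 1/4`** — the body of the route's deciding theorem
`KarlinRubin.closes` with the two cruxes excised: Karp's bridge (`cliqueCircuitsOfNotPneNP_proof`, i.e.
`NP ⊆ P/poly ⇒` polynomial circuits for `CLIQUE(n, t)` uniformly in `t ≤ n`) at `t(n) = 3⌊log₂ n⌋ + 3` is a family of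
size `≤ n^{c₁}` whose type-II error is `0` eventually and whose type-I error tends to `0` by the proved first-moment
item `karlinRubin_erdosRenyiNoLargeClique_proof`. [folklore] -/
theorem polyB2Detector_of_not_pneNP (hne : ¬ PneNP) :
    ∃ c : ℕ, ∃ C : (n : ℕ) → Circuit ((⊤ : SimpleGraph (Fin n)).edgeSet),
      (∀ᶠ n : ℕ in atTop, (C n).IsOver B2 ∧ (C n).size ≤ n ^ c) ∧
        Tendsto (fun n : ℕ =>
          (erdosRenyiHalf n).toOuterMeasure {x | (C n).eval x = true} +
            (plantedCliqueDist n ⌈(n : ℝ) ^ (1 / 2 - 1 / 4 : ℝ)⌉₊).toOuterMeasure {x | (C n).eval x = false})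
          atTop (𝓝 0) := by
  classical
  have hE : ErdosRenyiNoLargeClique := karlinRubin_erdosRenyiNoLargeClique_proof
  -- (1) polynomial B₂-circuits for the clique functions, from the bridge
  obtain ⟨c₁, hc₁⟩ := cliqueCircuitsOfNotPneNP_proof hne
  -- (2) the clique size `t n = 3 ⌊log₂ n⌋ + 3`
  let t : ℕ → ℕ := fun n => 3 * Nat.log 2 n + 3
  have ht_logb : ∀ n : ℕ, (2 + 1) * Real.logb 2 (n : ℝ) ≤ (t n : ℝ) := by
    intro n
    rcases Nat.eq_zero_or_pos n with hn | hn
    · subst hn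
      simp [t]
    · have hlt : (n : ℝ) < (2 : ℝ) ^ ((Nat.log 2 n + 1 : ℕ) : ℝ) := by
        rw [Real.rpow_natCast]
        exact_mod_cast Nat.lt_pow_succ_log_self (by norm_num : 1 < 2) n
      have hlogb : Real.logb 2 (n : ℝ) < ((Nat.log 2 n + 1 : ℕ) : ℝ) :=
        (Real.logb_lt_iff_lt_rpow (by norm_num) (by exact_mod_cast hn)).2 hlt
      have : (t n : ℝ) = 3 * ((Nat.log 2 n + 1 : ℕ) : ℝ) := by
        simp only [t]; push_cast; ring
      rw [this]
      linarith
  have hgrow : ∀ᶠ n : ℕ in Filter.atTop, t n ≤ ⌈(n : ℝ) ^ (1 / 2 - 1 / 4 : ℝ)⌉₊ ∧ t n ≤ n := by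
    have h1 : Filter.Tendsto (fun n : ℕ => Real.log (n : ℝ) / (n : ℝ) ^ (1 / 4 : ℝ)) Filter.atTop (nhds 0) :=
      ((isLittleO_log_rpow_atTop (by norm_num : (0 : ℝ) < 1 / 4)).comp_tendsto
        tendsto_natCast_atTop_atTop).tendsto_div_nhds_zero
    have h2 : ∀ᶠ n : ℕ in Filter.atTop, Real.log (n : ℝ) / (n : ℝ) ^ (1 / 4 : ℝ) < Real.log 2 / 6 :=
      h1.eventually (gt_mem_nhds (by positivity))
    have h3 : ∀ᶠ n : ℕ in Filter.atTop, (6 : ℝ) ≤ (n : ℝ) ^ (1 / 4 : ℝ) :=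
      ((tendsto_rpow_atTop (by norm_num : (0 : ℝ) < 1 / 4)).comp tendsto_natCast_atTop_atTop).eventually_ge_atTop 6
    filter_upwards [h2, h3, Filter.eventually_ge_atTop 1] with n h2 h3 hn1
    have hnpos : (0 : ℝ) < n := by exact_mod_cast hn1
    have hrpos : 0 < (n : ℝ) ^ (1 / 4 : ℝ) := Real.rpow_pos_of_pos hnpos _
    have hlog2 : 0 < Real.log 2 := Real.log_pos one_lt_two
    have hnat : ((Nat.log 2 n : ℕ) : ℝ) ≤ Real.logb 2 (n : ℝ) := by
      rw [Real.le_logb_iff_rpow_le (by norm_num) hnpos, Real.rpow_natCast]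
      exact_mod_cast Nat.pow_log_le_self 2 (by omega)
    have hlogb_le : Real.logb 2 (n : ℝ) ≤ (n : ℝ) ^ (1 / 4 : ℝ) / 6 := by
      rw [Real.logb, div_le_div_iff₀ hlog2 (by norm_num : (0:ℝ) < 6)]
      have := (div_lt_iff₀ hrpos).1 h2
      nlinarith
    have hreal : (t n : ℝ) ≤ (n : ℝ) ^ (1 / 4 : ℝ) := by
      have : (t n : ℝ) = 3 * ((Nat.log 2 n : ℕ) : ℝ) + 3 := by simp only [t]; push_cast; ring
      rw [this]
      nlinarith
    have hexp : (1 / 2 - 1 / 4 : ℝ) = 1 / 4 := by norm_num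
    constructor
    · rw [hexp]
      have : (t n : ℝ) ≤ (⌈(n : ℝ) ^ (1 / 4 : ℝ)⌉₊ : ℝ) := hreal.trans (Nat.le_ceil _)
      exact_mod_cast this
    · have hle : (n : ℝ) ^ (1 / 4 : ℝ) ≤ n := by
        conv_rhs => rw [← Real.rpow_one (n : ℝ)]
        exact Real.rpow_le_rpow_of_exponent_le (by exact_mod_cast hn1) (by norm_num)
      exact_mod_cast hreal.trans hle
  -- (3) the circuit family (junk outside the eventual range)
  let F : (n : ℕ) → (((⊤ : SimpleGraph (Fin n)).edgeSet → Bool) → Bool) := fun n x =>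
    decide (¬ (SimpleGraph.fromEdgeSet {e : Sym2 (Fin n) | ∃ h : e ∈ (⊤ : SimpleGraph (Fin n)).edgeSet, x ⟨e, h⟩ = true}).CliqueFree (t n))
  let P : (n : ℕ) → Prop := fun n =>
    ∃ C : Circuit ((⊤ : SimpleGraph (Fin n)).edgeSet), C.IsOver B2 ∧ C.size ≤ n ^ c₁ ∧ C.Computes (F n)
  let C : (n : ℕ) → Circuit ((⊤ : SimpleGraph (Fin n)).edgeSet) :=
    fun n => if h : P n then h.choose else Circuit.const _ false
  have hCP : ∀ᶠ n : ℕ in Filter.atTop, (C n).IsOver B2 ∧ (C n).size ≤ n ^ c₁ ∧ (C n).Computes (F n) := by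
    filter_upwards [hc₁, hgrow] with n hn hg
    have hP : P n := hn (t n) hg.2
    have hC : C n = hP.choose := dif_pos hP
    rw [hC]
    exact hP.choose_spec
  -- the circuit accepts exactly the graphs with a `t n`-clique
  have hevT : ∀ n : ℕ, (C n).Computes (F n) → ∀ x, (C n).eval x = true ↔
      ∃ S : Finset (Fin n), S.card = t n ∧ (graphOfEdgeVec x).IsClique (S : Set (Fin n)) := by
    intro n hn x
    rw [hn x]
    simp only [F, decide_eq_true_eq, SimpleGraph.CliqueFree, not_forall, not_not]
    constructor
    · rintro ⟨S, hS⟩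
      exact ⟨S, hS.card_eq, hS.isClique⟩
    · rintro ⟨S, h1, h2⟩
      exact ⟨S, ⟨h2, h1⟩⟩
  -- (4a) type-I error → 0 (first-moment bound `hE`)
  have hI : Filter.Tendsto (fun n : ℕ => (erdosRenyiHalf n).toOuterMeasure {x | (C n).eval x = true})
      Filter.atTop (nhds 0) := by
    have hE' := hE t ⟨1, one_pos, Filter.Eventually.of_forall ht_logb⟩
    refine hE'.congr' ?_
    filter_upwards [hCP] with n hn
    congr 1
    ext x
    simp only [Set.mem_setOf_eq]
    exact (hevT n hn.2.2 x).symm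
  -- (4b) type-II error = 0 eventually (the planted clique contains a `t n`-clique)
  have hII : ∀ᶠ n : ℕ in Filter.atTop,
      (plantedCliqueDist n ⌈(n : ℝ) ^ (1 / 2 - 1 / 4 : ℝ)⌉₊).toOuterMeasure {x | (C n).eval x = false} = 0 := by
    filter_upwards [hCP, hgrow] with n hn hg
    rw [PMF.toOuterMeasure_apply_eq_zero_iff, Set.disjoint_left]
    intro x hx hxf
    rw [plantedCliqueDist, PMF.support_map] at hx
    obtain ⟨p, hp, rfl⟩ := hx
    obtain ⟨hcard, hcl⟩ := mem_support_plantedCliqueJoint hp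
    have hle : t n ≤ p.1.card := by rw [hcard]; exact le_min hg.1 hg.2
    obtain ⟨S, hSsub, hScard⟩ := Finset.exists_subset_card_eq hle
    have hclS : (graphOfEdgeVec p.2).IsClique (S : Set (Fin n)) := hcl.subset (by exact_mod_cast hSsub)
    have htrue : (C n).eval p.2 = true := (hevT n hn.2.2 p.2).2 ⟨S, hScard, hclS⟩
    simp only [Set.mem_setOf_eq] at hxf
    rw [htrue] at hxf
    exact Bool.noConfusion hxf
  have hsum : Filter.Tendsto (fun n : ℕ =>
      (erdosRenyiHalf n).toOuterMeasure {x | (C n).eval x = true}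
        + (plantedCliqueDist n ⌈(n : ℝ) ^ (1 / 2 - 1 / 4 : ℝ)⌉₊).toOuterMeasure {x | (C n).eval x = false})
      Filter.atTop (nhds 0) := by
    refine hI.congr' ?_
    filter_upwards [hII] with n hn
    rw [hn, add_zero]
  exact ⟨c₁, C, hCP.mono fun n h => ⟨h.1, h.2.1⟩, hsum⟩

/-- **Polynomial `B₂` planted-clique hardness at the single exponent `δ = 1/4` closes the summit alone.**
(What route KarlinRubin's `closes` contradicts is exactly a polynomial `B₂` detector at `δ = 1/4`; its two cruxes
`MonotoneSuffices ∧ MonotoneBlind` are used only to manufacture `PolyHardB2At (1/4)`.) [folklore] -/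
theorem pneNP_of_polyHardB2At_quarter (H : PolyHardB2At (1 / 4)) : PneNP := by
  by_contra hne
  obtain ⟨c, C, hC, hT⟩ := polyB2Detector_of_not_pneNP hne
  exact H c ⟨C, hC, hT⟩

/-- **Registered form** (stub `pneNP_of_noPolyB2DetectorAt_quarter` of stmt-PneNP-18026; `PolyHardB2At (1/4)`
unfolded): no polynomial `B₂` family strongly detects the planted `⌈n^{1/4}⌉`-clique ⟹ `PneNP`. [folklore] -/
theorem pneNP_of_noPolyB2DetectorAt_quarter :
    (∀ c : ℕ, ¬ ∃ C : (n : ℕ) → Circuit ((⊤ : SimpleGraph (Fin n)).edgeSet), (∀ᶠ n : ℕ in atTop, (C n).IsOver B2 ∧ (C n).size ≤ n ^ c) ∧ Tendsto (fun n : ℕ => (erdosRenyiHalf n).toOuterMeasure {x | (C n).eval x = true} + (plantedCliqueDist n ⌈(n : ℝ) ^ (1 / 2 - 1 / 4 : ℝ)⌉₊).toOuterMeasure {x | (C n).eval x = false}) atTop (nhds 0)) → PneNP :=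
  fun H => pneNP_of_polyHardB2At_quarter H

/-- `PolyHardB2 → PneNP`. [folklore] -/
theorem pneNP_of_polyHardB2 (H : PolyHardB2) : PneNP :=
  pneNP_of_polyHardB2At_quarter (H (1 / 4) (by norm_num) (by norm_num))

/-- **The dominating hypothesis of `MonotoneSuffices` closes the summit alone.** `QuasiPolyHardB2 → PneNP`, through the
route's own deciding theorem: `QuasiPolyHardB2 → MonotoneSuffices` (landed sandwich), `QuasiPolyHardB2 → PolyHardB2 →
MonotoneBlind` (landed), and `closes` with its two proved supports. [folklore] -/
theorem pneNP_of_quasipolyHardB2 (H : QuasiPolyHardB2) : PneNP :=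
  -- route KarlinRubin was retired (2026-08-17) and its route file no longer carries `closes`;
  -- the same conclusion through this file's own chain `QuasiPolyHardB2 → PolyHardB2 → PneNP`
  pneNP_of_polyHardB2 (polyHardB2_of_quasipolyHardB2 H)

end Summit.PneNP.PneNP.Theorems
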